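import Summits.Ventures.PercRepro.Night2ExcessMass

/-!
# PercRepro — the `(7, 5)` cell `(3, 1)` in the per-basis excess regime (night-2, gen 20)

For `8 ≤ n = |G| − 1 ≤ 19` the chord of `1/(m + 3)` over `2 ≤ m ≤ n − 4` bounds the excess of every covering
basis by `excessBound` (`17/40` at `n = 8` down to `173/1080` at `n = 19`, against the crude `ρ λ = 11/24`), and the
target sum `genSum n 5 3 c′ (E/5) ≥ 1` holds with `m₁ = 3` (non-basis thin members miss `≥ 3` points) at every
`n`, and with no hypothesis (`m₁ = 2`) at `n ∈ {8, 17, 18, 19}`.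
**`localShadowHall_three_one_five_of_excess`**: (LI_G) at the cell for `9 ≤ |G| ≤ 20` given `m₁ = 3` only for
`10 ≤ |G| ≤ 17` — the residue of `Night2SevenFiveResidues` (`|G| ≤ 20 ∧ fat 0/5 ∧ fat 5/3 ∧ basis 4 ∧ …`) shrinks
to `10 ≤ |G| ≤ 17 ∧ fat 5/2 ∧ basis 4 ∧ …`.
-/

namespace PercRepro.Shadow

open Finset PerFlat ThmH

namespace DGenP

/-- The chord of `1/(m + 3)` over `2 ≤ m ≤ 4` (cell `(3, 1)`, `n = 8`). -/
theorem chord_three_one_8 : ∀ m : ℕ, 2 ≤ m → m ≤ 4 →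
    1 / ((m : ℚ) + ((3 : ℕ) : ℚ)) ≤ (9 / 35 : ℚ) - (1 / 35 : ℚ) * (m : ℚ) := by
  intro m h1 h2
  interval_cases m <;> norm_num

/-- `excessBound = 17/40` at `(3, 1)`, `n = 8`. -/
theorem excessBound_three_one_8 : excessBound 5 3 5 1 8 (9 / 35 : ℚ) (1 / 35 : ℚ) = (17 / 40 : ℚ) := by
  unfold excessBound capDG phiQ; norm_num

/-- The target sum of the cell `(3, 1)` at `n = 8` with `m₁ = 2`: `17/40 · C(8, 5) ≤ c′ A + T` with `A = 0`, `T = 37`. -/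
theorem sum_three_one_8_m2 : 1 ≤ DGenP.genSum 8 5 3 (cPrimeDGP 5 3 5 1 2)
    (excessBound 5 3 5 1 8 (9 / 35 : ℚ) (1 / 35 : ℚ) / ((5 : ℕ) : ℚ)) := by
  have hc : cPrimeDGP 5 3 5 1 2 = (1 / 120 : ℚ) := by unfold cPrimeDGP capDG reqDGP phiQ; norm_num
  have hA : DGen.Aρt 8 5 3 = 0 := by decide
  have hT : DGen.Ttop 8 3 = 37 := by decide
  have hC : Nat.choose 8 5 = 56 := by decide
  rw [excessBound_three_one_8, hc, DGenP.genSum_eq (by norm_num) (by norm_num) (by norm_num), hA, hT, hC]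
  norm_num

/-- The chord of `1/(m + 3)` over `2 ≤ m ≤ 5` (cell `(3, 1)`, `n = 9`). -/
theorem chord_three_one_9 : ∀ m : ℕ, 2 ≤ m → m ≤ 5 →
    1 / ((m : ℚ) + ((3 : ℕ) : ℚ)) ≤ (1 / 4 : ℚ) - (1 / 40 : ℚ) * (m : ℚ) := by
  intro m h1 h2
  interval_cases m <;> norm_num

/-- `excessBound = 89/240` at `(3, 1)`, `n = 9`. -/
theorem excessBound_three_one_9 : excessBound 5 3 5 1 9 (1 / 4 : ℚ) (1 / 40 : ℚ) = (89 / 240 : ℚ) := by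
  unfold excessBound capDG phiQ; norm_num

/-- The target sum of the cell `(3, 1)` at `n = 9` with `m₁ = 3`: `89/240 · C(9, 5) ≤ c′ A + T` with `A = 84`, `T = 46`. -/
theorem sum_three_one_9_m3 : 1 ≤ DGenP.genSum 9 5 3 (cPrimeDGP 5 3 5 1 3)
    (excessBound 5 3 5 1 9 (1 / 4 : ℚ) (1 / 40 : ℚ) / ((5 : ℕ) : ℚ)) := by
  have hc : cPrimeDGP 5 3 5 1 3 = (1 / 8 : ℚ) := by unfold cPrimeDGP capDG reqDGP phiQ; norm_num
  have hA : DGen.Aρt 9 5 3 = 84 := by decide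
  have hT : DGen.Ttop 9 3 = 46 := by decide
  have hC : Nat.choose 9 5 = 126 := by decide
  rw [excessBound_three_one_9, hc, DGenP.genSum_eq (by norm_num) (by norm_num) (by norm_num), hA, hT, hC]
  norm_num

/-- The chord of `1/(m + 3)` over `2 ≤ m ≤ 6` (cell `(3, 1)`, `n = 10`). -/
theorem chord_three_one_10 : ∀ m : ℕ, 2 ≤ m → m ≤ 6 →
    1 / ((m : ℚ) + ((3 : ℕ) : ℚ)) ≤ (11 / 45 : ℚ) - (1 / 45 : ℚ) * (m : ℚ) := by
  intro m h1 h2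
  interval_cases m <;> norm_num

/-- `excessBound = 71/216` at `(3, 1)`, `n = 10`. -/
theorem excessBound_three_one_10 : excessBound 5 3 5 1 10 (11 / 45 : ℚ) (1 / 45 : ℚ) = (71 / 216 : ℚ) := by
  unfold excessBound capDG phiQ; norm_num

/-- The target sum of the cell `(3, 1)` at `n = 10` with `m₁ = 3`: `71/216 · C(10, 5) ≤ c′ A + T` with `A = 330`, `T = 56`. -/
theorem sum_three_one_10_m3 : 1 ≤ DGenP.genSum 10 5 3 (cPrimeDGP 5 3 5 1 3)
    (excessBound 5 3 5 1 10 (11 / 45 : ℚ) (1 / 45 : ℚ) / ((5 : ℕ) : ℚ)) := by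
  have hc : cPrimeDGP 5 3 5 1 3 = (1 / 8 : ℚ) := by unfold cPrimeDGP capDG reqDGP phiQ; norm_num
  have hA : DGen.Aρt 10 5 3 = 330 := by decide
  have hT : DGen.Ttop 10 3 = 56 := by decide
  have hC : Nat.choose 10 5 = 252 := by decide
  rw [excessBound_three_one_10, hc, DGenP.genSum_eq (by norm_num) (by norm_num) (by norm_num), hA, hT, hC]
  norm_num

/-- The chord of `1/(m + 3)` over `2 ≤ m ≤ 7` (cell `(3, 1)`, `n = 11`). -/
theorem chord_three_one_11 : ∀ m : ℕ, 2 ≤ m → m ≤ 7 →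
    1 / ((m : ℚ) + ((3 : ℕ) : ℚ)) ≤ (6 / 25 : ℚ) - (1 / 50 : ℚ) * (m : ℚ) := by
  intro m h1 h2
  interval_cases m <;> norm_num

/-- `excessBound = 59/200` at `(3, 1)`, `n = 11`. -/
theorem excessBound_three_one_11 : excessBound 5 3 5 1 11 (6 / 25 : ℚ) (1 / 50 : ℚ) = (59 / 200 : ℚ) := by
  unfold excessBound capDG phiQ; norm_num

/-- The target sum of the cell `(3, 1)` at `n = 11` with `m₁ = 3`: `59/200 · C(11, 5) ≤ c′ A + T` with `A = 957`, `T = 67`. -/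
theorem sum_three_one_11_m3 : 1 ≤ DGenP.genSum 11 5 3 (cPrimeDGP 5 3 5 1 3)
    (excessBound 5 3 5 1 11 (6 / 25 : ℚ) (1 / 50 : ℚ) / ((5 : ℕ) : ℚ)) := by
  have hc : cPrimeDGP 5 3 5 1 3 = (1 / 8 : ℚ) := by unfold cPrimeDGP capDG reqDGP phiQ; norm_num
  have hA : DGen.Aρt 11 5 3 = 957 := by decide
  have hT : DGen.Ttop 11 3 = 67 := by decide
  have hC : Nat.choose 11 5 = 462 := by decide
  rw [excessBound_three_one_11, hc, DGenP.genSum_eq (by norm_num) (by norm_num) (by norm_num), hA, hT, hC]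
  norm_num

/-- The chord of `1/(m + 3)` over `2 ≤ m ≤ 8` (cell `(3, 1)`, `n = 12`). -/
theorem chord_three_one_12 : ∀ m : ℕ, 2 ≤ m → m ≤ 8 →
    1 / ((m : ℚ) + ((3 : ℕ) : ℚ)) ≤ (13 / 55 : ℚ) - (1 / 55 : ℚ) * (m : ℚ) := by
  intro m h1 h2
  interval_cases m <;> norm_num

/-- `excessBound = 353/1320` at `(3, 1)`, `n = 12`. -/
theorem excessBound_three_one_12 : excessBound 5 3 5 1 12 (13 / 55 : ℚ) (1 / 55 : ℚ) = (353 / 1320 : ℚ) := by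
  unfold excessBound capDG phiQ; norm_num

/-- The target sum of the cell `(3, 1)` at `n = 12` with `m₁ = 3`: `353/1320 · C(12, 5) ≤ c′ A + T` with `A = 2431`, `T = 79`. -/
theorem sum_three_one_12_m3 : 1 ≤ DGenP.genSum 12 5 3 (cPrimeDGP 5 3 5 1 3)
    (excessBound 5 3 5 1 12 (13 / 55 : ℚ) (1 / 55 : ℚ) / ((5 : ℕ) : ℚ)) := by
  have hc : cPrimeDGP 5 3 5 1 3 = (1 / 8 : ℚ) := by unfold cPrimeDGP capDG reqDGP phiQ; norm_num
  have hA : DGen.Aρt 12 5 3 = 2431 := by decide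
  have hT : DGen.Ttop 12 3 = 79 := by decide
  have hC : Nat.choose 12 5 = 792 := by decide
  rw [excessBound_three_one_12, hc, DGenP.genSum_eq (by norm_num) (by norm_num) (by norm_num), hA, hT, hC]
  norm_num

/-- The chord of `1/(m + 3)` over `2 ≤ m ≤ 9` (cell `(3, 1)`, `n = 13`). -/
theorem chord_three_one_13 : ∀ m : ℕ, 2 ≤ m → m ≤ 9 →
    1 / ((m : ℚ) + ((3 : ℕ) : ℚ)) ≤ (7 / 30 : ℚ) - (1 / 60 : ℚ) * (m : ℚ) := by
  intro m h1 h2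
  interval_cases m <;> norm_num

/-- `excessBound = 11/45` at `(3, 1)`, `n = 13`. -/
theorem excessBound_three_one_13 : excessBound 5 3 5 1 13 (7 / 30 : ℚ) (1 / 60 : ℚ) = (11 / 45 : ℚ) := by
  unfold excessBound capDG phiQ; norm_num

/-- The target sum of the cell `(3, 1)` at `n = 13` with `m₁ = 3`: `11/45 · C(13, 5) ≤ c′ A + T` with `A = 5720`, `T = 92`. -/
theorem sum_three_one_13_m3 : 1 ≤ DGenP.genSum 13 5 3 (cPrimeDGP 5 3 5 1 3)
    (excessBound 5 3 5 1 13 (7 / 30 : ℚ) (1 / 60 : ℚ) / ((5 : ℕ) : ℚ)) := by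
  have hc : cPrimeDGP 5 3 5 1 3 = (1 / 8 : ℚ) := by unfold cPrimeDGP capDG reqDGP phiQ; norm_num
  have hA : DGen.Aρt 13 5 3 = 5720 := by decide
  have hT : DGen.Ttop 13 3 = 92 := by decide
  have hC : Nat.choose 13 5 = 1287 := by decide
  rw [excessBound_three_one_13, hc, DGenP.genSum_eq (by norm_num) (by norm_num) (by norm_num), hA, hT, hC]
  norm_num

/-- The chord of `1/(m + 3)` over `2 ≤ m ≤ 10` (cell `(3, 1)`, `n = 14`). -/
theorem chord_three_one_14 : ∀ m : ℕ, 2 ≤ m → m ≤ 10 →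
    1 / ((m : ℚ) + ((3 : ℕ) : ℚ)) ≤ (3 / 13 : ℚ) - (1 / 65 : ℚ) * (m : ℚ) := by
  intro m h1 h2
  interval_cases m <;> norm_num

/-- `excessBound = 9/40` at `(3, 1)`, `n = 14`. -/
theorem excessBound_three_one_14 : excessBound 5 3 5 1 14 (3 / 13 : ℚ) (1 / 65 : ℚ) = (9 / 40 : ℚ) := by
  unfold excessBound capDG phiQ; norm_num

/-- The target sum of the cell `(3, 1)` at `n = 14` with `m₁ = 3`: `9/40 · C(14, 5) ≤ c′ A + T` with `A = 12805`, `T = 106`. -/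
theorem sum_three_one_14_m3 : 1 ≤ DGenP.genSum 14 5 3 (cPrimeDGP 5 3 5 1 3)
    (excessBound 5 3 5 1 14 (3 / 13 : ℚ) (1 / 65 : ℚ) / ((5 : ℕ) : ℚ)) := by
  have hc : cPrimeDGP 5 3 5 1 3 = (1 / 8 : ℚ) := by unfold cPrimeDGP capDG reqDGP phiQ; norm_num
  have hA : DGen.Aρt 14 5 3 = 12805 := by decide
  have hT : DGen.Ttop 14 3 = 106 := by decide
  have hC : Nat.choose 14 5 = 2002 := by decide
  rw [excessBound_three_one_14, hc, DGenP.genSum_eq (by norm_num) (by norm_num) (by norm_num), hA, hT, hC]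
  norm_num

/-- The chord of `1/(m + 3)` over `2 ≤ m ≤ 11` (cell `(3, 1)`, `n = 15`). -/
theorem chord_three_one_15 : ∀ m : ℕ, 2 ≤ m → m ≤ 11 →
    1 / ((m : ℚ) + ((3 : ℕ) : ℚ)) ≤ (8 / 35 : ℚ) - (1 / 70 : ℚ) * (m : ℚ) := by
  intro m h1 h2
  interval_cases m <;> norm_num

/-- `excessBound = 5/24` at `(3, 1)`, `n = 15`. -/
theorem excessBound_three_one_15 : excessBound 5 3 5 1 15 (8 / 35 : ℚ) (1 / 70 : ℚ) = (5 / 24 : ℚ) := by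
  unfold excessBound capDG phiQ; norm_num

/-- The target sum of the cell `(3, 1)` at `n = 15` with `m₁ = 3`: `5/24 · C(15, 5) ≤ c′ A + T` with `A = 27703`, `T = 121`. -/
theorem sum_three_one_15_m3 : 1 ≤ DGenP.genSum 15 5 3 (cPrimeDGP 5 3 5 1 3)
    (excessBound 5 3 5 1 15 (8 / 35 : ℚ) (1 / 70 : ℚ) / ((5 : ℕ) : ℚ)) := by
  have hc : cPrimeDGP 5 3 5 1 3 = (1 / 8 : ℚ) := by unfold cPrimeDGP capDG reqDGP phiQ; norm_num
  have hA : DGen.Aρt 15 5 3 = 27703 := by decide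
  have hT : DGen.Ttop 15 3 = 121 := by decide
  have hC : Nat.choose 15 5 = 3003 := by decide
  rw [excessBound_three_one_15, hc, DGenP.genSum_eq (by norm_num) (by norm_num) (by norm_num), hA, hT, hC]
  norm_num

/-- The chord of `1/(m + 3)` over `2 ≤ m ≤ 12` (cell `(3, 1)`, `n = 16`). -/
theorem chord_three_one_16 : ∀ m : ℕ, 2 ≤ m → m ≤ 12 →
    1 / ((m : ℚ) + ((3 : ℕ) : ℚ)) ≤ (17 / 75 : ℚ) - (1 / 75 : ℚ) * (m : ℚ) := by
  intro m h1 h2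
  interval_cases m <;> norm_num

/-- `excessBound = 349/1800` at `(3, 1)`, `n = 16`. -/
theorem excessBound_three_one_16 : excessBound 5 3 5 1 16 (17 / 75 : ℚ) (1 / 75 : ℚ) = (349 / 1800 : ℚ) := by
  unfold excessBound capDG phiQ; norm_num

/-- The target sum of the cell `(3, 1)` at `n = 16` with `m₁ = 3`: `349/1800 · C(16, 5) ≤ c′ A + T` with `A = 58514`, `T = 137`. -/
theorem sum_three_one_16_m3 : 1 ≤ DGenP.genSum 16 5 3 (cPrimeDGP 5 3 5 1 3)
    (excessBound 5 3 5 1 16 (17 / 75 : ℚ) (1 / 75 : ℚ) / ((5 : ℕ) : ℚ)) := by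
  have hc : cPrimeDGP 5 3 5 1 3 = (1 / 8 : ℚ) := by unfold cPrimeDGP capDG reqDGP phiQ; norm_num
  have hA : DGen.Aρt 16 5 3 = 58514 := by decide
  have hT : DGen.Ttop 16 3 = 137 := by decide
  have hC : Nat.choose 16 5 = 4368 := by decide
  rw [excessBound_three_one_16, hc, DGenP.genSum_eq (by norm_num) (by norm_num) (by norm_num), hA, hT, hC]
  norm_num

/-- The chord of `1/(m + 3)` over `2 ≤ m ≤ 13` (cell `(3, 1)`, `n = 17`). -/
theorem chord_three_one_17 : ∀ m : ℕ, 2 ≤ m → m ≤ 13 →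
    1 / ((m : ℚ) + ((3 : ℕ) : ℚ)) ≤ (9 / 40 : ℚ) - (1 / 80 : ℚ) * (m : ℚ) := by
  intro m h1 h2
  interval_cases m <;> norm_num

/-- `excessBound = 29/160` at `(3, 1)`, `n = 17`. -/
theorem excessBound_three_one_17 : excessBound 5 3 5 1 17 (9 / 40 : ℚ) (1 / 80 : ℚ) = (29 / 160 : ℚ) := by
  unfold excessBound capDG phiQ; norm_num

/-- The target sum of the cell `(3, 1)` at `n = 17` with `m₁ = 2`: `29/160 · C(17, 5) ≤ c′ A + T` with `A = 121516`, `T = 154`. -/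
theorem sum_three_one_17_m2 : 1 ≤ DGenP.genSum 17 5 3 (cPrimeDGP 5 3 5 1 2)
    (excessBound 5 3 5 1 17 (9 / 40 : ℚ) (1 / 80 : ℚ) / ((5 : ℕ) : ℚ)) := by
  have hc : cPrimeDGP 5 3 5 1 2 = (1 / 120 : ℚ) := by unfold cPrimeDGP capDG reqDGP phiQ; norm_num
  have hA : DGen.Aρt 17 5 3 = 121516 := by decide
  have hT : DGen.Ttop 17 3 = 154 := by decide
  have hC : Nat.choose 17 5 = 6188 := by decide
  rw [excessBound_three_one_17, hc, DGenP.genSum_eq (by norm_num) (by norm_num) (by norm_num), hA, hT, hC]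
  norm_num

/-- The chord of `1/(m + 3)` over `2 ≤ m ≤ 14` (cell `(3, 1)`, `n = 18`). -/
theorem chord_three_one_18 : ∀ m : ℕ, 2 ≤ m → m ≤ 14 →
    1 / ((m : ℚ) + ((3 : ℕ) : ℚ)) ≤ (19 / 85 : ℚ) - (1 / 85 : ℚ) * (m : ℚ) := by
  intro m h1 h2
  interval_cases m <;> norm_num

/-- `excessBound = 347/2040` at `(3, 1)`, `n = 18`. -/
theorem excessBound_three_one_18 : excessBound 5 3 5 1 18 (19 / 85 : ℚ) (1 / 85 : ℚ) = (347 / 2040 : ℚ) := by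
  unfold excessBound capDG phiQ; norm_num

/-- The target sum of the cell `(3, 1)` at `n = 18` with `m₁ = 2`: `347/2040 · C(18, 5) ≤ c′ A + T` with `A = 249356`, `T = 172`. -/
theorem sum_three_one_18_m2 : 1 ≤ DGenP.genSum 18 5 3 (cPrimeDGP 5 3 5 1 2)
    (excessBound 5 3 5 1 18 (19 / 85 : ℚ) (1 / 85 : ℚ) / ((5 : ℕ) : ℚ)) := by
  have hc : cPrimeDGP 5 3 5 1 2 = (1 / 120 : ℚ) := by unfold cPrimeDGP capDG reqDGP phiQ; norm_num
  have hA : DGen.Aρt 18 5 3 = 249356 := by decide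
  have hT : DGen.Ttop 18 3 = 172 := by decide
  have hC : Nat.choose 18 5 = 8568 := by decide
  rw [excessBound_three_one_18, hc, DGenP.genSum_eq (by norm_num) (by norm_num) (by norm_num), hA, hT, hC]
  norm_num

/-- The chord of `1/(m + 3)` over `2 ≤ m ≤ 15` (cell `(3, 1)`, `n = 19`). -/
theorem chord_three_one_19 : ∀ m : ℕ, 2 ≤ m → m ≤ 15 →
    1 / ((m : ℚ) + ((3 : ℕ) : ℚ)) ≤ (2 / 9 : ℚ) - (1 / 90 : ℚ) * (m : ℚ) := by
  intro m h1 h2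
  interval_cases m <;> norm_num

/-- `excessBound = 173/1080` at `(3, 1)`, `n = 19`. -/
theorem excessBound_three_one_19 : excessBound 5 3 5 1 19 (2 / 9 : ℚ) (1 / 90 : ℚ) = (173 / 1080 : ℚ) := by
  unfold excessBound capDG phiQ; norm_num

/-- The target sum of the cell `(3, 1)` at `n = 19` with `m₁ = 2`: `173/1080 · C(19, 5) ≤ c′ A + T` with `A = 507433`, `T = 191`. -/
theorem sum_three_one_19_m2 : 1 ≤ DGenP.genSum 19 5 3 (cPrimeDGP 5 3 5 1 2)
    (excessBound 5 3 5 1 19 (2 / 9 : ℚ) (1 / 90 : ℚ) / ((5 : ℕ) : ℚ)) := by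
  have hc : cPrimeDGP 5 3 5 1 2 = (1 / 120 : ℚ) := by unfold cPrimeDGP capDG reqDGP phiQ; norm_num
  have hA : DGen.Aρt 19 5 3 = 507433 := by decide
  have hT : DGen.Ttop 19 3 = 191 := by decide
  have hC : Nat.choose 19 5 = 11628 := by decide
  rw [excessBound_three_one_19, hc, DGenP.genSum_eq (by norm_num) (by norm_num) (by norm_num), hA, hT, hC]
  norm_num

end DGenP

variable {α : Type*} [DecidableEq α] {M : Matroid α} [M.Finite]

open DGenP in
open scoped Classical in
/-- **THE `(7, 5)` CELL `(3, 1)` IN THE PER-BASIS EXCESS REGIME**, `9 ≤ |G| ≤ 20`: every thin member with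
`|B ∖ K| ≥ 5` misses at least `3` points when `10 ≤ |G| ≤ 17` (no hypothesis at `|G| ∈ {9, 18, 19, 20}`). -/
theorem localShadowHall_three_one_five_of_excess {G : Finset α} (hG : G ∈ flatsQ M (5 + 1))
    (hd : (gr M \ G).card = 3) (hk : kColoops M G = 1)
    (hs : ∀ e ∈ gr M, ∀ f ∈ gr M, e ≠ f → rkN M {e, f} = 2) (hl : ∀ e ∈ gr M, M.Indep {e})
    (hn1 : 9 ≤ G.card) (hn2 : G.card ≤ 20)
    (hm₁ : 10 ≤ G.card → G.card ≤ 17 →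
      ∀ B ∈ thinMembers M 5 G, 5 ≤ (B \ coloops M G).card → 3 ≤ (G \ clF M B).card) :
    LocalShadowHall M 5 G := by
  have hk' : kColoops M G + 5 = 5 + 1 := by omega
  have hm2 : ∀ B ∈ thinMembers M 5 G, 5 ≤ (B \ coloops M G).card → 2 ≤ (G \ clF M B).card :=
    fun B hB _ => two_le_card_sdiff_of_not_lay0 hG (by omega) (mem_thinMembers.1 hB).1 (mem_thinMembers.1 hB).2
  have hc2 : 0 ≤ cPrimeDGP 5 3 5 (kColoops M G) 2 := by rw [hk]; unfold cPrimeDGP capDG reqDGP phiQ; norm_num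
  have hc3 : 0 ≤ cPrimeDGP 5 3 5 (kColoops M G) 3 := by rw [hk]; unfold cPrimeDGP capDG reqDGP phiQ; norm_num
  obtain ⟨n, hn⟩ : ∃ n, G.card - kColoops M G = n := ⟨_, rfl⟩
  have hn1' : 8 ≤ n := by omega
  have hn2' : n ≤ 19 := by omega
  interval_cases n
  · exact localShadowHall_excess_of_sum (d := 3) (ρ := 5) (m₁ := 2) hG hd (by norm_num) hk' (by norm_num)
      (by omega) hs hl hc2 hm2 (a := (9 / 35 : ℚ)) (b := (1 / 35 : ℚ)) (by norm_num)
      (by rw [hn]; intro m h1 h2; exact chord_three_one_8 m h1 (by omega))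
      (by rw [hn, hk, excessBound_three_one_8]; norm_num) (by rw [hn, hk]; exact sum_three_one_8_m2)
  · exact localShadowHall_excess_of_sum (d := 3) (ρ := 5) (m₁ := 3) hG hd (by norm_num) hk' (by norm_num)
      (by omega) hs hl hc3 (hm₁ (by omega) (by omega)) (a := (1 / 4 : ℚ)) (b := (1 / 40 : ℚ)) (by norm_num)
      (by rw [hn]; intro m h1 h2; exact chord_three_one_9 m h1 (by omega))
      (by rw [hn, hk, excessBound_three_one_9]; norm_num) (by rw [hn, hk]; exact sum_three_one_9_m3)
  · exact localShadowHall_excess_of_sum (d := 3) (ρ := 5) (m₁ := 3) hG hd (by norm_num) hk' (by norm_num)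
      (by omega) hs hl hc3 (hm₁ (by omega) (by omega)) (a := (11 / 45 : ℚ)) (b := (1 / 45 : ℚ)) (by norm_num)
      (by rw [hn]; intro m h1 h2; exact chord_three_one_10 m h1 (by omega))
      (by rw [hn, hk, excessBound_three_one_10]; norm_num) (by rw [hn, hk]; exact sum_three_one_10_m3)
  · exact localShadowHall_excess_of_sum (d := 3) (ρ := 5) (m₁ := 3) hG hd (by norm_num) hk' (by norm_num)
      (by omega) hs hl hc3 (hm₁ (by omega) (by omega)) (a := (6 / 25 : ℚ)) (b := (1 / 50 : ℚ)) (by norm_num)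
      (by rw [hn]; intro m h1 h2; exact chord_three_one_11 m h1 (by omega))
      (by rw [hn, hk, excessBound_three_one_11]; norm_num) (by rw [hn, hk]; exact sum_three_one_11_m3)
  · exact localShadowHall_excess_of_sum (d := 3) (ρ := 5) (m₁ := 3) hG hd (by norm_num) hk' (by norm_num)
      (by omega) hs hl hc3 (hm₁ (by omega) (by omega)) (a := (13 / 55 : ℚ)) (b := (1 / 55 : ℚ)) (by norm_num)
      (by rw [hn]; intro m h1 h2; exact chord_three_one_12 m h1 (by omega))
      (by rw [hn, hk, excessBound_three_one_12]; norm_num) (by rw [hn, hk]; exact sum_three_one_12_m3)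
  · exact localShadowHall_excess_of_sum (d := 3) (ρ := 5) (m₁ := 3) hG hd (by norm_num) hk' (by norm_num)
      (by omega) hs hl hc3 (hm₁ (by omega) (by omega)) (a := (7 / 30 : ℚ)) (b := (1 / 60 : ℚ)) (by norm_num)
      (by rw [hn]; intro m h1 h2; exact chord_three_one_13 m h1 (by omega))
      (by rw [hn, hk, excessBound_three_one_13]; norm_num) (by rw [hn, hk]; exact sum_three_one_13_m3)
  · exact localShadowHall_excess_of_sum (d := 3) (ρ := 5) (m₁ := 3) hG hd (by norm_num) hk' (by norm_num)
      (by omega) hs hl hc3 (hm₁ (by omega) (by omega)) (a := (3 / 13 : ℚ)) (b := (1 / 65 : ℚ)) (by norm_num)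
      (by rw [hn]; intro m h1 h2; exact chord_three_one_14 m h1 (by omega))
      (by rw [hn, hk, excessBound_three_one_14]; norm_num) (by rw [hn, hk]; exact sum_three_one_14_m3)
  · exact localShadowHall_excess_of_sum (d := 3) (ρ := 5) (m₁ := 3) hG hd (by norm_num) hk' (by norm_num)
      (by omega) hs hl hc3 (hm₁ (by omega) (by omega)) (a := (8 / 35 : ℚ)) (b := (1 / 70 : ℚ)) (by norm_num)
      (by rw [hn]; intro m h1 h2; exact chord_three_one_15 m h1 (by omega))
      (by rw [hn, hk, excessBound_three_one_15]; norm_num) (by rw [hn, hk]; exact sum_three_one_15_m3)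
  · exact localShadowHall_excess_of_sum (d := 3) (ρ := 5) (m₁ := 3) hG hd (by norm_num) hk' (by norm_num)
      (by omega) hs hl hc3 (hm₁ (by omega) (by omega)) (a := (17 / 75 : ℚ)) (b := (1 / 75 : ℚ)) (by norm_num)
      (by rw [hn]; intro m h1 h2; exact chord_three_one_16 m h1 (by omega))
      (by rw [hn, hk, excessBound_three_one_16]; norm_num) (by rw [hn, hk]; exact sum_three_one_16_m3)
  · exact localShadowHall_excess_of_sum (d := 3) (ρ := 5) (m₁ := 2) hG hd (by norm_num) hk' (by norm_num)
      (by omega) hs hl hc2 hm2 (a := (9 / 40 : ℚ)) (b := (1 / 80 : ℚ)) (by norm_num)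
      (by rw [hn]; intro m h1 h2; exact chord_three_one_17 m h1 (by omega))
      (by rw [hn, hk, excessBound_three_one_17]; norm_num) (by rw [hn, hk]; exact sum_three_one_17_m2)
  · exact localShadowHall_excess_of_sum (d := 3) (ρ := 5) (m₁ := 2) hG hd (by norm_num) hk' (by norm_num)
      (by omega) hs hl hc2 hm2 (a := (19 / 85 : ℚ)) (b := (1 / 85 : ℚ)) (by norm_num)
      (by rw [hn]; intro m h1 h2; exact chord_three_one_18 m h1 (by omega))
      (by rw [hn, hk, excessBound_three_one_18]; norm_num) (by rw [hn, hk]; exact sum_three_one_18_m2)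
  · exact localShadowHall_excess_of_sum (d := 3) (ρ := 5) (m₁ := 2) hG hd (by norm_num) hk' (by norm_num)
      (by omega) hs hl hc2 hm2 (a := (2 / 9 : ℚ)) (b := (1 / 90 : ℚ)) (by norm_num)
      (by rw [hn]; intro m h1 h2; exact chord_three_one_19 m h1 (by omega))
      (by rw [hn, hk, excessBound_three_one_19]; norm_num) (by rw [hn, hk]; exact sum_three_one_19_m2)

end PercRepro.Shadow
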